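import Summits.QuantumFields.YangMills.Theorems.UnitScaleTiltFluctuationComparisonRegPrGlobalSlackKernelLegChi
import HarnessLib

/-!
# `UnitScaleTiltFluctuationComparisonRegPrGlobalSlackKernelLegRef` — THE TWO-RUN ROWS OF 3⁗χ AS PER-RUN ROWS AGAINST RUN-INDEPENDENT REFERENCE OBJECTS
# (crux `FluctuationComparisonRegPrIntL`, stmt-QuantumFields-20520, skeleton v5kC, STUB 3⁗χ `stub_globalTwoRunSlackFamChi`; width seat ym-ust-20520-w1 g0, count-neutral helper)

WHY.  By name, 3⁗χ is `GlobalSlackKernelLeg.K1aLegRowsRChi` (★r1 g4, `…KernelLegChi`): five analytic leg rows over ONE chart family `(Φ, e, B)` at the χ-record's canonical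
polymerisation.  Three of them — (43) `KernelLegPointwiseΦ`, (44) `CfgDistΦ`, the seventh-order residual row — speak, clause by clause, about ONE run's package.  Two do not:
K1a `FlatKernelLegCauchyΦ` (run `K+1`'s transported flat kernels against run `K`'s) and `CfgDistCauchyΦ` (run `K+1`'s loop variables against run `K`'s).  Over the per-`K`
`Classical.choice` witnesses of the hypothesis `OfV3ChiAt` (a SEPARATE existential for every `K`) a genuinely cross-`K` row is unprovable in principle (finding F-g4-1, OWNER
RULING g20-№3 §1: a statement about `Classical.choice`'s value is provable only if it holds for EVERY admissible witness).  [King1986]'s own mechanism for Thm 3.4 is not a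
bare two-run statement either: Prop. 3.6 (3.56) compares the `k`-step and the `(k+n)`-step graph amplitudes through the slice decomposition (3.58)–(3.61) and is UNIFORM IN `n`,
i.e. each run's `k`-step kernels are within `L^{−γk}` of the `n → ∞` LIMIT kernels — a PER-RUN statement against a run-independent reference.  This file types that reading:

* §1 `KerHeightFree Ψ` (a reference chart family whose flat kernels of orders 2…6 are EXACTLY matched across the two runs along the bond transport — the limit family),
  the per-run row `KernelRefΦ D Φ Ψ dist κ′ κ a C` (run `K`'s weighted kernels at `(b, Y)` AND run `K+1`'s at `(b+1, refineSet Y)` are each within `C·e^{−κ𝓛}·(L^{−(1+b)})^a`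
  of the reference — two clauses, each about ONE run, indexed like the rows of record), `flatKernelLegCauchyΦ_of_heightFree` (a height-free family carries K1a with `C = 0`)
  and **`flatKernelLegCauchyΦ_of_ref`**: `KerHeightFree Ψ → KernelRefΦ D Φ Ψ … C → FlatKernelLegCauchyΦ D Φ … (2C)` (triangle inequality).
* §2 the same for the loop variables: `RefCfgCoherent BR` (a reference configuration functional of the coarse field, matched across the runs), the per-run row
  `CfgRefΦ D B BR dist b₀ p₀ a C_B`, **`cfgDistCauchyΦ_of_ref`**: `RefCfgCoherent BR → CfgRefΦ … C_B → CfgDistCauchyΦ … (2C_B)`.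
* §3 the sockets **`K1aLegRowsRefChi`** (ALL FIVE rows per-run; the reference objects `Ψ, BR` are quantified BEFORE the hypothesis `OfV3ChiAt`, so they depend on the family,
  the record and the coupling only — never on the (α) witnesses) and **`K1aLegRowsRefKChi`** (kernels per-run, loop variables two-run as before), the reductions
  `k1aLegRowsRChi_of_RefChi`, `k1aLegRowsRChi_of_RefKChi`, and the capstones **`globalTwoRunSlackFamChi_of_k1aLegRowsRefChi`** / **`…_of_k1aLegRowsRefKChi`** :
  ⟨THE TEXT OF `stub_globalTwoRunSlackFamChi` VERBATIM⟩.
CONSEQUENCE FOR THE v4 (α) RECORD (NODE O): 3⁗χ closes over per-`K` choice witnesses as soon as each run's record DISPLAYS, besides (43)/(44)/(M1)+(57), the closeness of its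
step charts' flat kernels to a FIXED height-free reference family (a tree `def`, [King1986] Prop. 3.6's limit kernels) and of its loop variables to a FIXED coherent reference
functional — no recipe for a coherent family and no two-run row inside the record are needed.  HONEST FRAMING: hypothesis schemas + triangle inequalities; nothing of
[Balaban1985UV3] / [King1986] is asserted; registry untouched; YM₃ on T³ (route `UnitScaleTilt`) is a rung, not the Clay problem, not 𝕋⁴, not a mass gap.

References: C. King, CMP 102 (1986) 649–677 [King1986] (Thm 3.4 (3.9) p.656, Prop. 3.6 (3.56) p.662, (3.58)–(3.61) p.663, Prop. 3.9 (3.71)–(3.74) p.665); T. Bałaban,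
CMP 102 (1985) 255–275 [Balaban1985UV3] ((43)–(45) pp.266–267, (57) p.270); CMP 109 (1987) 249–301 [Balaban1987RG1] ((0.1) p.251).
-/

set_option autoImplicit false

noncomputable section

open scoped BigOperators
open Finset
open Literature.MathematicalPhysics.QuantumFieldTheory.Balaban1983to89
open Literature.MathematicalPhysics.QuantumFieldTheory.Balaban1983to89.T3ContinuumYM3Torus
open Literature.MathematicalPhysics.QuantumFieldTheory.Balaban1983to89.T3UnitScaleTilt
open Literature.MathematicalPhysics.QuantumFieldTheory.Balaban1983to89.T3LevelShift
open Literature.MathematicalPhysics.QuantumFieldTheory.Balaban1983to89.T3AlphaInputsAC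
open Literature.MathematicalPhysics.QuantumFieldTheory.Balaban1983to89.T3AlphaPolymerSocket
open Literature.MathematicalPhysics.QuantumFieldTheory.Balaban1983to89.T3AlphaInputsACTwoRun
open Literature.MathematicalPhysics.QuantumFieldTheory.Balaban1983to89.T3AlphaInputsACTwoRunLevel
open Literature.MathematicalPhysics.QuantumFieldTheory.Balaban1985CMP102
open Literature.MathematicalPhysics.QuantumFieldTheory.Balaban1985CMP102.Setting
open Summit.QuantumFields.Balaban3D.Carriers
open Summit.QuantumFields.Balaban3D.Proofs.Primitives
open Summit.QuantumFields.Balaban3D.Proofs.GroupModelLieC (lieC)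
open Summit.QuantumFields.Balaban3D.Proofs.Representation33 (jet26)
open Summit.QuantumFields.YangMills.Theorems
open Summit.QuantumFields.YangMills.Theorems.GlobalSlackKernelMatching
open Summit.QuantumFields.YangMills.Theorems.GlobalSlackCanonicalPolymers

namespace Summit.QuantumFields.YangMills.Theorems.GlobalSlackKernelLeg

/-! ## §1 Flat kernels: a height-free reference family and the per-run closeness row -/

section Kernels

variable {𝕍 : Type} [NormedAddCommGroup 𝕍] [NormedSpace ℂ 𝕍] {F : T3Family} {γ : ℝ}

/-- **KERNEL-LEVEL HEIGHT-FREENESS of a (reference) chart family** (hypothesis schema on `Ψ`, never asserted): for every run `K`, chart index `b`, point set `Y` and order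
`2 ≤ d ≤ 6`, the order-`d` flat kernel of run `K+1` at `(b+1, refineSet Y)` pulled back along the bond matching IS the order-`d` flat kernel of run `K` at `(b, Y)` — the
property of [King1986]'s `n → ∞` limit kernels (the limit along `(K+n, b+n, refineSet^n Y)` is the same object one step later). [cite: King1986, Prop. 3.6 (3.56) p.662, (3.58)-(3.61) p.663] -/
def KerHeightFree (Ψ : ChartFam 𝕍 F) : Prop :=
  ∀ (K b : ℕ) (Y : Set (Site (F.P K) 0)), ∀ d ∈ Finset.Ico 2 7, kerT Ψ K b Y d = ker Ψ K b Y d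

/-- **THE PER-RUN KERNEL CLOSENESS ROW against a reference family `Ψ`** (hypothesis schema, never asserted; leg currency, indexed like the rows of record): for every
`Y ∈ Loc K k triv (1+b)` and `2 ≤ d ≤ 6`, (i) run `K`'s weighted order-`d` flat kernel at `(b, Y)` is within `C·e^{−κ𝓛_K(Y)}·(L^{−(1+b)})^a` of the reference kernel at
`(b, Y)`, and (ii) run `K+1`'s transported weighted kernel at `(b+1, refineSet Y)` is within the same budget of the transported reference kernel — each clause mentions ONE
run's charts only ([King1986] Prop. 3.6 read as «`k`-step kernels are within `L^{−γk}` of the limit kernels», uniformly in the number of extra slices).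
[cite: King1986, Prop. 3.6 (3.56) p.662, (3.58)-(3.61) p.663; Balaban1985UV3, (43) p.266, (45) p.267] -/
def KernelRefΦ (D : AlphaDataT3 F γ) (Φ Ψ : ChartFam 𝕍 F) (dist : LegDist F) (κ' κ a C : ℝ) : Prop :=
  ∀ (K k b : ℕ) (Y : Set (Site (F.P K) 0)), Y ∈ D.Loc K k (D.triv K k) (1 + b) →
    ∀ d ∈ Finset.Ico 2 7,
      ‖(ker Φ K b Y d - ker Ψ K b Y d).compContinuousLinearMap fun _ => legL 𝕍 dist κ' K b Y‖ ≤
          C * Real.exp (-κ * D.treeLen K (1 + b) Y) * (((F.L : ℝ) ^ (1 + b))⁻¹) ^ a ∧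
      ‖(kerT Φ K b Y d - kerT Ψ K b Y d).compContinuousLinearMap fun _ => legL 𝕍 dist κ' K b Y‖ ≤
          C * Real.exp (-κ * D.treeLen K (1 + b) Y) * (((F.L : ℝ) ^ (1 + b))⁻¹) ^ a

/-- Precomposing the zero multilinear map gives zero. [folklore] -/
theorem zero_compContinuousLinearMap_legL {n : ℕ} {K b : ℕ} (T : (PBond (F.P K) b → 𝕍) →L[ℂ] (PBond (F.P K) b → 𝕍)) :
    (0 : ContinuousMultilinearMap ℂ (fun _ : Fin n => PBond (F.P K) b → 𝕍) ℂ).compContinuousLinearMap (fun _ => T) = 0 := by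
  ext v
  simp only [ContinuousMultilinearMap.compContinuousLinearMap_apply, zero_apply]

/-- **A HEIGHT-FREE FAMILY CARRIES K1a WITH CONSTANT `0`** (any datum, leg distance, weights, decay, rate): the transported kernel minus the kernel vanishes.
[cite: King1986, Prop. 3.6 (3.56) p.662] -/
theorem flatKernelLegCauchyΦ_of_heightFree {D : AlphaDataT3 F γ} {Ψ : ChartFam 𝕍 F} (h : KerHeightFree Ψ) (dist : LegDist F) (κ' κ a : ℝ) :
    FlatKernelLegCauchyΦ D Ψ dist κ' κ a 0 := by
  intro K k b Y _hY d hd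
  rw [h K b Y d hd, sub_self, zero_compContinuousLinearMap_legL, norm_zero, zero_mul, zero_mul]

/-- **K1a FROM THE PER-RUN REFERENCE ROW** (triangle inequality through the height-free reference): `KerHeightFree Ψ ∧ KernelRefΦ D Φ Ψ dist κ′ κ a C ⟹
FlatKernelLegCauchyΦ D Φ dist κ′ κ a (2C)` — run `K+1`'s transported kernel and run `K`'s kernel are each `C`-close to the (matched) reference kernels.
[cite: King1986, Prop. 3.6 (3.56) p.662, Prop. 3.9 (3.74) p.665] -/
theorem flatKernelLegCauchyΦ_of_ref {D : AlphaDataT3 F γ} {Φ Ψ : ChartFam 𝕍 F} {dist : LegDist F} {κ' κ a C : ℝ}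
    (hΨ : KerHeightFree Ψ) (h : KernelRefΦ D Φ Ψ dist κ' κ a C) : FlatKernelLegCauchyΦ D Φ dist κ' κ a (2 * C) := by
  intro K k b Y hY d hd
  obtain ⟨h1, h2⟩ := h K k b Y hY d hd
  have hsplit : kerT Φ K b Y d - ker Φ K b Y d = (kerT Φ K b Y d - kerT Ψ K b Y d) - (ker Φ K b Y d - ker Ψ K b Y d) := by
    rw [hΨ K b Y d hd]; abel
  rw [hsplit, sub_compContinuousLinearMap]
  calc ‖(kerT Φ K b Y d - kerT Ψ K b Y d).compContinuousLinearMap (fun _ => legL 𝕍 dist κ' K b Y) -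
          (ker Φ K b Y d - ker Ψ K b Y d).compContinuousLinearMap (fun _ => legL 𝕍 dist κ' K b Y)‖
      ≤ ‖(kerT Φ K b Y d - kerT Ψ K b Y d).compContinuousLinearMap (fun _ => legL 𝕍 dist κ' K b Y)‖ +
          ‖(ker Φ K b Y d - ker Ψ K b Y d).compContinuousLinearMap (fun _ => legL 𝕍 dist κ' K b Y)‖ := norm_sub_le _ _
    _ ≤ C * Real.exp (-κ * D.treeLen K (1 + b) Y) * (((F.L : ℝ) ^ (1 + b))⁻¹) ^ a +
          C * Real.exp (-κ * D.treeLen K (1 + b) Y) * (((F.L : ℝ) ^ (1 + b))⁻¹) ^ a := add_le_add h2 h1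
    _ = 2 * C * Real.exp (-κ * D.treeLen K (1 + b) Y) * (((F.L : ℝ) ^ (1 + b))⁻¹) ^ a := by ring

end Kernels

/-! ## §2 Loop variables: a coherent reference functional and the per-run closeness row -/

section Configurations

variable {𝕍 : Type} [NormedAddCommGroup 𝕍] [NormedSpace ℂ 𝕍] {F : T3Family} {γ : ℝ}

/-- **COHERENCE OF A REFERENCE CONFIGURATION FUNCTIONAL across the two runs** (hypothesis schema on `BR`, never asserted): read at the height-`n` field `V` (shifted to lattice
level `K − n` of run `K`, resp. `K + 1 − n` of run `K+1`), the reference loop variable of run `K+1` at `(j+1, refineSet Y)` on the matched bond equals that of run `K` at `(j, Y)`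
on the bond — the property of the loop variables of ONE limiting background read on both runs' lattices. [cite: King1986, Prop. 3.9 (3.71)-(3.72) p.665; Balaban1987RG1, (0.1) p.251] -/
def RefCfgCoherent (BR : CfgFam 𝕍 F) : Prop :=
  ∀ (K n : ℕ) (h : n ≤ K), ∀ j : ℕ, j < K - n →
    ∀ (V : GaugeField (F.P n) 0 (Matrix.specialUnitaryGroup (Fin 2) ℂ)) (Y : Set (Site (F.P K) 0)) (c : PBond (F.P K) j),
      BR (K + 1) (K + 1 - n) (j + 1) (refineSet F K Y)
          (fieldShift (F.sitesPerDir_eq (m := F.m) (K := K + 1) (j := K + 1 - n) (m' := F.m) (K' := n) (j' := 0) (by omega)) V) (matchBond F K j c) =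
        BR K (K - n) j Y (fieldShift (F.sitesPerDir_eq (m := F.m) (K := K) (j := K - n) (m' := F.m) (K' := n) (j' := 0) (by omega)) V) c

/-- **THE PER-RUN LOOP-VARIABLE CLOSENESS ROW against a reference functional `BR`** (hypothesis schema, never asserted; distance form, window profile `p₀`, indexed like
`CfgDistCauchyΦ`): on the `θ(n)`-window and every `Y ∈ Loc K (K−n) triv (1+j)`, leg by leg, (i) run `K`'s loop variable at `(j, Y)` is within
`C_B·(1 + d(c))·θ(n)·x²·(L^{−(1+j)})^a` of the reference, and (ii) run `K+1`'s at `(j+1, refineSet Y)` on the matched bond is within the same budget of the reference there —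
each clause mentions ONE run's configurations only (the 19200-side comparison read as «each run's background is close to the limiting background»).
[cite: King1986, Prop. 3.9 (3.71)-(3.72) p.665; Balaban1985UV3, (44) p.267] -/
def CfgRefΦ (D : AlphaDataT3 F γ) (B BR : CfgFam 𝕍 F) (dist : LegDist F) (b₀ p₀ a C_B : ℝ) : Prop :=
  ∀ (K n : ℕ) (h : n ≤ K), ∀ j : ℕ, j < K - n →
    ∀ V : GaugeField (F.P n) 0 (Matrix.specialUnitaryGroup (Fin 2) ℂ), PlaqSmall (θBal F.L γ b₀ p₀ n) V →
      ∀ Y ∈ D.Loc K (K - n) (D.triv K (K - n)) (1 + j), ∀ c : PBond (F.P K) j,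
        ‖B K (K - n) j Y (fieldShift (F.sitesPerDir_eq (m := F.m) (K := K) (j := K - n) (m' := F.m) (K' := n) (j' := 0) (by omega)) V) c -
            BR K (K - n) j Y (fieldShift (F.sitesPerDir_eq (m := F.m) (K := K) (j := K - n) (m' := F.m) (K' := n) (j' := 0) (by omega)) V) c‖ ≤
          C_B * (1 + dist K j Y c) * θBal F.L γ b₀ p₀ n * (((F.L : ℝ) ^ (K - n - 1 - j))⁻¹) ^ 2 * (((F.L : ℝ) ^ (1 + j))⁻¹) ^ a ∧
        ‖B (K + 1) (K + 1 - n) (j + 1) (refineSet F K Y)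
              (fieldShift (F.sitesPerDir_eq (m := F.m) (K := K + 1) (j := K + 1 - n) (m' := F.m) (K' := n) (j' := 0) (by omega)) V) (matchBond F K j c) -
            BR (K + 1) (K + 1 - n) (j + 1) (refineSet F K Y)
              (fieldShift (F.sitesPerDir_eq (m := F.m) (K := K + 1) (j := K + 1 - n) (m' := F.m) (K' := n) (j' := 0) (by omega)) V) (matchBond F K j c)‖ ≤
          C_B * (1 + dist K j Y c) * θBal F.L γ b₀ p₀ n * (((F.L : ℝ) ^ (K - n - 1 - j))⁻¹) ^ 2 * (((F.L : ℝ) ^ (1 + j))⁻¹) ^ a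

omit [NormedSpace ℂ 𝕍] in
/-- **`CfgDistCauchyΦ` FROM THE PER-RUN REFERENCE ROW** (triangle inequality through the coherent reference): `RefCfgCoherent BR ∧ CfgRefΦ D B BR dist b₀ p₀ a C_B ⟹
CfgDistCauchyΦ D B dist b₀ p₀ a (2C_B)`. [cite: King1986, Prop. 3.9 (3.71)-(3.72) p.665] -/
theorem cfgDistCauchyΦ_of_ref {D : AlphaDataT3 F γ} {B BR : CfgFam 𝕍 F} {dist : LegDist F} {b₀ p₀ a C_B : ℝ}
    (hcoh : RefCfgCoherent BR) (h : CfgRefΦ D B BR dist b₀ p₀ a C_B) : CfgDistCauchyΦ D B dist b₀ p₀ a (2 * C_B) := by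
  intro K n hn j hj V hV Y hY c
  obtain ⟨h1, h2⟩ := h K n hn j hj V hV Y hY c
  have hc := hcoh K n hn j hj V Y c
  -- abbreviate the four vectors
  set x' := B (K + 1) (K + 1 - n) (j + 1) (refineSet F K Y)
      (fieldShift (F.sitesPerDir_eq (m := F.m) (K := K + 1) (j := K + 1 - n) (m' := F.m) (K' := n) (j' := 0) (by omega)) V) (matchBond F K j c) with hx'
  set r' := BR (K + 1) (K + 1 - n) (j + 1) (refineSet F K Y)
      (fieldShift (F.sitesPerDir_eq (m := F.m) (K := K + 1) (j := K + 1 - n) (m' := F.m) (K' := n) (j' := 0) (by omega)) V) (matchBond F K j c) with hr'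
  set x := B K (K - n) j Y (fieldShift (F.sitesPerDir_eq (m := F.m) (K := K) (j := K - n) (m' := F.m) (K' := n) (j' := 0) (by omega)) V) c with hx
  set r := BR K (K - n) j Y (fieldShift (F.sitesPerDir_eq (m := F.m) (K := K) (j := K - n) (m' := F.m) (K' := n) (j' := 0) (by omega)) V) c with hr
  have hsplit : x' - x = (x' - r') + (r - x) := by rw [hc]; abel
  rw [hsplit]
  calc ‖x' - r' + (r - x)‖ ≤ ‖x' - r'‖ + ‖r - x‖ := norm_add_le _ _
    _ = ‖x' - r'‖ + ‖x - r‖ := by rw [norm_sub_rev r x]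
    _ ≤ C_B * (1 + dist K j Y c) * θBal F.L γ b₀ p₀ n * (((F.L : ℝ) ^ (K - n - 1 - j))⁻¹) ^ 2 * (((F.L : ℝ) ^ (1 + j))⁻¹) ^ a +
        C_B * (1 + dist K j Y c) * θBal F.L γ b₀ p₀ n * (((F.L : ℝ) ^ (K - n - 1 - j))⁻¹) ^ 2 * (((F.L : ℝ) ^ (1 + j))⁻¹) ^ a := add_le_add h2 h1
    _ = 2 * C_B * (1 + dist K j Y c) * θBal F.L γ b₀ p₀ n * (((F.L : ℝ) ^ (K - n - 1 - j))⁻¹) ^ 2 * (((F.L : ℝ) ^ (1 + j))⁻¹) ^ a := by ring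

end Configurations

/-! ## §3 The per-run sockets for 3⁗χ and the registered text, by name -/

/-- **3⁗χ IN PER-RUN CURRENCY** (hypothesis schema, never asserted): `K1aLegRowsRChi` with its two cross-run rows replaced by per-run closeness rows against reference objects
that are quantified BEFORE the (α) hypothesis — rates `0 < κ′ < κ₁`, nonnegative constants, a threshold `γB`, and for every family / coupling a HEIGHT-FREE reference chart
family `Ψ` and a COHERENT reference configuration functional `BR` such that, for every inhabited χ-package, a coherent `p : ∀ K, PkgAtV3Chi …` and ONE chart family
`(Φ, e, B)` carry: `KernelRefΦ` (each run's kernels near `Ψ`'s), (43) `KernelLegPointwiseΦ`, the residual row `RemainderSmallΦ … (residualRemCore …)`, (44) `CfgDistΦ`,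
`CfgRefΦ` (each run's loop variables near `BR`) — every clause of every row mentions ONE run's package, so each is dischargeable from that run's displayed record rows for
EVERY admissible witness (the F-g4-1 criterion). [cite: King1986, Thm 3.4 (3.9) p.656, Prop. 3.6 (3.56) p.662, Prop. 3.9 (3.71)-(3.74) p.665; Balaban1985UV3, (43)-(45) pp.266-267, (57) p.270] -/
def K1aLegRowsRefChi (L : ℕ) (𝔠 : AlphaConsts L (suGroupModel 2).N) (a₀ a₁ a : ℝ) : Prop :=
  ∃ (κ' κ₁ C A C_R C_s C_B γB : ℝ), 0 < κ' ∧ κ' < κ₁ ∧ 0 ≤ C ∧ 0 ≤ A ∧ 0 ≤ C_R ∧ 0 ≤ C_s ∧ 0 ≤ C_B ∧ 0 < γB ∧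
    ∀ (F : T3Family) (γ : ℝ) (hF : F.L = L) (hγ : 0 < γ), γ ≤ γB → ∀ (hγ1 : γ ≤ (min (hF ▸ 𝔠).gamma0 1) ^ 2),
      ∃ (Ψ : ChartFam ↥(lieC (suGroupModel 2)) F) (BR : CfgFam ↥(lieC (suGroupModel 2)) F), KerHeightFree Ψ ∧ RefCfgCoherent BR ∧
        (AlphaInputsT3AC.OfV3ChiAt F (hF ▸ 𝔠) a₀ a₁ →
          ∃ (p : ∀ K, AlphaInputsT3AC.PkgAtV3Chi F (hF ▸ 𝔠) γ hγ hγ1 K), (∀ K, (p K).a₀ = a₀ ∧ (p K).a₁ = a₁) ∧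
            ∃ (Φ : ChartFam ↥(lieC (suGroupModel 2)) F) (e : VacFam F) (B : CfgFam ↥(lieC (suGroupModel 2)) F),
              KernelRefΦ (AlphaInputsT3AC.dataOfV3chi p (canonPolymerCore fun K => (p K).toCore)) Φ Ψ (canonLegDist F) κ' (hF ▸ 𝔠).κ a C ∧
              KernelLegPointwiseΦ (AlphaInputsT3AC.dataOfV3chi p (canonPolymerCore fun K => (p K).toCore)) Φ (canonLegDist F) κ₁ (hF ▸ 𝔠).κ A ∧
              RemainderSmallΦ (AlphaInputsT3AC.dataOfV3chi p (canonPolymerCore fun K => (p K).toCore)) (residualRemCore (fun K => (p K).toCore) Φ e B)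
                (hF ▸ 𝔠).b₀ (hF ▸ 𝔠).p₀ (hF ▸ 𝔠).κ C_R ∧
              CfgDistΦ (AlphaInputsT3AC.dataOfV3chi p (canonPolymerCore fun K => (p K).toCore)) B (canonLegDist F) (hF ▸ 𝔠).b₀ (hF ▸ 𝔠).p₀ C_s ∧
              CfgRefΦ (AlphaInputsT3AC.dataOfV3chi p (canonPolymerCore fun K => (p K).toCore)) B BR (canonLegDist F) (hF ▸ 𝔠).b₀ (hF ▸ 𝔠).p₀ a C_B)

/-- **THE PER-RUN SOCKET GIVES 3⁗χ'S SOCKET OF RECORD**: `K1aLegRowsRefChi → K1aLegRowsRChi` (constants `2C`, `2C_B`; `flatKernelLegCauchyΦ_of_ref`, `cfgDistCauchyΦ_of_ref`).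
[cite: King1986, Prop. 3.6 (3.56) p.662, Prop. 3.9 (3.71)-(3.74) p.665] -/
theorem k1aLegRowsRChi_of_RefChi {L : ℕ} {𝔠 : AlphaConsts L (suGroupModel 2).N} {a₀ a₁ a : ℝ} (h : K1aLegRowsRefChi L 𝔠 a₀ a₁ a) :
    K1aLegRowsRChi L 𝔠 a₀ a₁ a := by
  obtain ⟨κ', κ₁, C, A, C_R, C_s, C_B, γB, hκ', hκ1, hC, hA, hCR, hCs, hCB, hγB, hall⟩ := h
  refine ⟨κ', κ₁, 2 * C, A, C_R, C_s, 2 * C_B, γB, hκ', hκ1, by linarith, hA, hCR, hCs, by linarith, hγB,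
    fun F γ hF hγ hγle hγ1 hOf => ?_⟩
  obtain ⟨Ψ, BR, hΨ, hBR, himp⟩ := hall F γ hF hγ hγle hγ1
  obtain ⟨p, hp, Φ, e, B, hK, hP, hR, hS, hBC⟩ := himp hOf
  exact ⟨p, hp, Φ, e, B, flatKernelLegCauchyΦ_of_ref hΨ hK, hP, hR, hS, cfgDistCauchyΦ_of_ref hBR hBC⟩

/-- **3⁗χ WITH THE KERNELS PER-RUN ONLY** (hypothesis schema, never asserted): `K1aLegRowsRChi` with K1a `FlatKernelLegCauchyΦ` replaced by `KernelRefΦ` against a height-free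
reference family quantified before the (α) hypothesis; the loop-variable comparison `CfgDistCauchyΦ` is kept in its two-run form (the 19200-side statement as the
variational problem delivers it). [cite: King1986, Thm 3.4 (3.9) p.656, Prop. 3.6 (3.56) p.662; Balaban1985UV3, (43)-(45) pp.266-267, (57) p.270] -/
def K1aLegRowsRefKChi (L : ℕ) (𝔠 : AlphaConsts L (suGroupModel 2).N) (a₀ a₁ a : ℝ) : Prop :=
  ∃ (κ' κ₁ C A C_R C_s C_B γB : ℝ), 0 < κ' ∧ κ' < κ₁ ∧ 0 ≤ C ∧ 0 ≤ A ∧ 0 ≤ C_R ∧ 0 ≤ C_s ∧ 0 ≤ C_B ∧ 0 < γB ∧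
    ∀ (F : T3Family) (γ : ℝ) (hF : F.L = L) (hγ : 0 < γ), γ ≤ γB → ∀ (hγ1 : γ ≤ (min (hF ▸ 𝔠).gamma0 1) ^ 2),
      ∃ (Ψ : ChartFam ↥(lieC (suGroupModel 2)) F), KerHeightFree Ψ ∧
        (AlphaInputsT3AC.OfV3ChiAt F (hF ▸ 𝔠) a₀ a₁ →
          ∃ (p : ∀ K, AlphaInputsT3AC.PkgAtV3Chi F (hF ▸ 𝔠) γ hγ hγ1 K), (∀ K, (p K).a₀ = a₀ ∧ (p K).a₁ = a₁) ∧
            ∃ (Φ : ChartFam ↥(lieC (suGroupModel 2)) F) (e : VacFam F) (B : CfgFam ↥(lieC (suGroupModel 2)) F),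
              KernelRefΦ (AlphaInputsT3AC.dataOfV3chi p (canonPolymerCore fun K => (p K).toCore)) Φ Ψ (canonLegDist F) κ' (hF ▸ 𝔠).κ a C ∧
              KernelLegPointwiseΦ (AlphaInputsT3AC.dataOfV3chi p (canonPolymerCore fun K => (p K).toCore)) Φ (canonLegDist F) κ₁ (hF ▸ 𝔠).κ A ∧
              RemainderSmallΦ (AlphaInputsT3AC.dataOfV3chi p (canonPolymerCore fun K => (p K).toCore)) (residualRemCore (fun K => (p K).toCore) Φ e B)
                (hF ▸ 𝔠).b₀ (hF ▸ 𝔠).p₀ (hF ▸ 𝔠).κ C_R ∧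
              CfgDistΦ (AlphaInputsT3AC.dataOfV3chi p (canonPolymerCore fun K => (p K).toCore)) B (canonLegDist F) (hF ▸ 𝔠).b₀ (hF ▸ 𝔠).p₀ C_s ∧
              CfgDistCauchyΦ (AlphaInputsT3AC.dataOfV3chi p (canonPolymerCore fun K => (p K).toCore)) B (canonLegDist F) (hF ▸ 𝔠).b₀ (hF ▸ 𝔠).p₀ a C_B)

/-- The kernels-per-run socket gives the socket of record: `K1aLegRowsRefKChi → K1aLegRowsRChi` (constant `2C`). [cite: King1986, Prop. 3.6 (3.56) p.662] -/
theorem k1aLegRowsRChi_of_RefKChi {L : ℕ} {𝔠 : AlphaConsts L (suGroupModel 2).N} {a₀ a₁ a : ℝ} (h : K1aLegRowsRefKChi L 𝔠 a₀ a₁ a) :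
    K1aLegRowsRChi L 𝔠 a₀ a₁ a := by
  obtain ⟨κ', κ₁, C, A, C_R, C_s, C_B, γB, hκ', hκ1, hC, hA, hCR, hCs, hCB, hγB, hall⟩ := h
  refine ⟨κ', κ₁, 2 * C, A, C_R, C_s, C_B, γB, hκ', hκ1, by linarith, hA, hCR, hCs, hCB, hγB, fun F γ hF hγ hγle hγ1 hOf => ?_⟩
  obtain ⟨Ψ, hΨ, himp⟩ := hall F γ hF hγ hγle hγ1
  obtain ⟨p, hp, Φ, e, B, hK, hP, hR, hS, hBC⟩ := himp hOf
  exact ⟨p, hp, Φ, e, B, flatKernelLegCauchyΦ_of_ref hΨ hK, hP, hR, hS, hBC⟩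

/-- **THE REGISTERED STUB 3⁗χ FROM THE PER-RUN SOCKET, BY NAME** (`globalTwoRunSlackFamChi_of_k1aLegRowsRChi ∘ k1aLegRowsRChi_of_RefChi`): if for every odd `L ≥ 7`, every
constants record and [7]-constants there is a rate exponent `0 < a < 1` with `K1aLegRowsRefChi L 𝔠 a₀ a₁ a`, then the text of `stub_globalTwoRunSlackFamChi` (skeleton v5kC
of stmt-QuantumFields-20520) holds VERBATIM. [cite: King1986, Thm 3.4 (3.9) p.656, Prop. 3.6 (3.56) p.662; Balaban1985UV3, (43)-(47) pp.266-267, (57) p.270] -/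
theorem globalTwoRunSlackFamChi_of_k1aLegRowsRefChi
    (h : ∀ (L : ℕ), Odd L → 7 ≤ L → ∀ (𝔠 : AlphaConsts L (suGroupModel 2).N) (a₀ a₁ : ℝ), 0 < a₀ → 0 < a₁ → 𝔠.B₃ * a₁ ≤ a₀ →
      ∃ a : ℝ, 0 < a ∧ a < 1 ∧ K1aLegRowsRefChi L 𝔠 a₀ a₁ a) :
    ∀ (L : ℕ), Odd L → 7 ≤ L → ∀ (𝔠 : Summit.QuantumFields.Balaban3D.Proofs.Primitives.AlphaConsts L (Summit.QuantumFields.Balaban3D.Carriers.suGroupModel 2).N)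
      (a₀ a₁ : ℝ), 0 < a₀ → 0 < a₁ → 𝔠.B₃ * a₁ ≤ a₀ →
      ∃ a : ℝ, 0 < a ∧ ∃ γB : ℝ, 0 < γB ∧ ∀ (F : T3Family) (γ : ℝ) (hF : F.L = L) (hγ : 0 < γ), γ ≤ γB →
        ∀ (hγ1 : γ ≤ (min (hF ▸ 𝔠).gamma0 1) ^ 2),
          Summit.QuantumFields.YangMills.Theorems.AlphaInputsT3AC.OfV3ChiAt F (hF ▸ 𝔠) a₀ a₁ →
          ∃ (p : ∀ K, Summit.QuantumFields.YangMills.Theorems.AlphaInputsT3AC.PkgAtV3Chi F (hF ▸ 𝔠) γ hγ hγ1 K),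
            (∀ K, (p K).a₀ = a₀ ∧ (p K).a₁ = a₁) ∧
            ∃ (π : Summit.QuantumFields.YangMills.Theorems.AlphaInputsT3AC.PolymerT3 F) (σ : ℕ) (C : ℝ), 7 ≤ σ ∧ 0 ≤ C ∧
              Summit.QuantumFields.YangMills.Theorems.GlobalSlack.GlobalSupRateTSlack (Summit.QuantumFields.YangMills.Theorems.AlphaInputsT3AC.dataOfV3chi p π) (hF ▸ 𝔠).b₀ (hF ▸ 𝔠).p₀ a σ C :=
  globalTwoRunSlackFamChi_of_k1aLegRowsRChi fun L hLo h7 𝔠 a₀ a₁ ha0 ha1 hw => by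
    obtain ⟨a, ha, ha1', hc⟩ := h L hLo h7 𝔠 a₀ a₁ ha0 ha1 hw
    exact ⟨a, ha, ha1', k1aLegRowsRChi_of_RefChi hc⟩

/-- **THE REGISTERED STUB 3⁗χ FROM THE KERNELS-PER-RUN SOCKET, BY NAME** (`globalTwoRunSlackFamChi_of_k1aLegRowsRChi ∘ k1aLegRowsRChi_of_RefKChi`).
[cite: King1986, Thm 3.4 (3.9) p.656, Prop. 3.6 (3.56) p.662; Balaban1985UV3, (43)-(47) pp.266-267, (57) p.270] -/
theorem globalTwoRunSlackFamChi_of_k1aLegRowsRefKChi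
    (h : ∀ (L : ℕ), Odd L → 7 ≤ L → ∀ (𝔠 : AlphaConsts L (suGroupModel 2).N) (a₀ a₁ : ℝ), 0 < a₀ → 0 < a₁ → 𝔠.B₃ * a₁ ≤ a₀ →
      ∃ a : ℝ, 0 < a ∧ a < 1 ∧ K1aLegRowsRefKChi L 𝔠 a₀ a₁ a) :
    ∀ (L : ℕ), Odd L → 7 ≤ L → ∀ (𝔠 : Summit.QuantumFields.Balaban3D.Proofs.Primitives.AlphaConsts L (Summit.QuantumFields.Balaban3D.Carriers.suGroupModel 2).N)
      (a₀ a₁ : ℝ), 0 < a₀ → 0 < a₁ → 𝔠.B₃ * a₁ ≤ a₀ →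
      ∃ a : ℝ, 0 < a ∧ ∃ γB : ℝ, 0 < γB ∧ ∀ (F : T3Family) (γ : ℝ) (hF : F.L = L) (hγ : 0 < γ), γ ≤ γB →
        ∀ (hγ1 : γ ≤ (min (hF ▸ 𝔠).gamma0 1) ^ 2),
          Summit.QuantumFields.YangMills.Theorems.AlphaInputsT3AC.OfV3ChiAt F (hF ▸ 𝔠) a₀ a₁ →
          ∃ (p : ∀ K, Summit.QuantumFields.YangMills.Theorems.AlphaInputsT3AC.PkgAtV3Chi F (hF ▸ 𝔠) γ hγ hγ1 K),
            (∀ K, (p K).a₀ = a₀ ∧ (p K).a₁ = a₁) ∧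
            ∃ (π : Summit.QuantumFields.YangMills.Theorems.AlphaInputsT3AC.PolymerT3 F) (σ : ℕ) (C : ℝ), 7 ≤ σ ∧ 0 ≤ C ∧
              Summit.QuantumFields.YangMills.Theorems.GlobalSlack.GlobalSupRateTSlack (Summit.QuantumFields.YangMills.Theorems.AlphaInputsT3AC.dataOfV3chi p π) (hF ▸ 𝔠).b₀ (hF ▸ 𝔠).p₀ a σ C :=
  globalTwoRunSlackFamChi_of_k1aLegRowsRChi fun L hLo h7 𝔠 a₀ a₁ ha0 ha1 hw => by
    obtain ⟨a, ha, ha1', hc⟩ := h L hLo h7 𝔠 a₀ a₁ ha0 ha1 hw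
    exact ⟨a, ha, ha1', k1aLegRowsRChi_of_RefKChi hc⟩

end Summit.QuantumFields.YangMills.Theorems.GlobalSlackKernelLeg

end
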